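import Literature.Probability.RandomPlanarGeometry.SAWLoopErasureMemoryTwo
import Literature.Probability.RandomPlanarGeometry.SAWLoopErasureKestenRenewalGreenChernoffSharp
import HarnessLib

/-!
# The third term of `μ(ℤ^d)`: `2d − 1 − 1/(2d) − 3/(4d²) − 95/d³ ≤ μ(ℤ^d)` (`d ≥ 22`) and the envelope
`|μ(ℤ^d) − (2d − 1 − 1/(2d) − 3/(4d²))| ≤ 95/d³` (`d ≥ 2`)

Topic `Literature/Probability/RandomPlanarGeometry`; a leaf over `SAWLoopErasureMemoryTwo.lean` (the memory-2 loop erasure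
with the "second version" constraint: `hss_memoryTwo_div_le_connectiveConstant : (∀ K, Σ_{j≤K} w̃_j (2d−1)^{−j} ≤ W) →
(2d−1)/W ≤ μ(ℤ^d)`, `w̃_j = nbwLoopsPen d j`, and `sum_nbwLoopsAll_mul_pow_le : Σ_{j≤K} b_j(0)(2d−1)^{−j} ≤ B₀ :=
((2d−2)/(2d−1)) G_d`), over `SAWLoopErasureKestenRenewalGreenChernoffSharp.lean` (`GreenChernoff.srwI_one_le_sharp₄ :
G_d ≤ 1 + 1/(2d) + 3/(4d²) + 3/(2d³) + 49/d⁴` for `d ≥ 22`; `twoTerm_sub_five_div_sq_le_connectiveConstant :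
2d − 1 − 1/(2d) − 5/d² ≤ μ(ℤ^d)` for `d ≥ 2`) and over `SAWMemorySixAllDimensions.lean` (`connectiveConstant_le_thirdOrder :
μ(ℤ^d) ≤ 2d − 1 − 1/(2d) − 3/(4d²) + 2/d³` for `d ≥ 2`), all used BY NAME.

## What the source prints (HSS93 = Hara–Slade–Sokal, J. Stat. Phys. 72 (1993) 479–517 = arXiv:hep-lat/9302003; `s = 1/(2d)`)

PDF p. 27 (printed p. 25), §6.3: "The standard of comparison for all our bounds is the series (6.2),
`μ = s⁻¹ − 1 − s − 3s² − 16s³ − 102s⁴ + …` (6.18) which is provably correct through order `s³` …".  "The simplest such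
bound (2.34) is based on `τ = 2, k = 0`; using (2.14) and (A.17), it becomes `μ^{(2,0)} = (2d−1)/C₂(0,0;1/(2d−1)) =
s⁻¹ − 1 − s − 6s² − 35s³ − 222s⁴ + O(s⁵)` (6.21)".  PDF p. 28 (printed p. 26): "This coefficient is however captured
correctly if we combine the constraints involving the previous and next steps on the backbone, i.e. if we go to `τ = 2̃`,
`k = 1`. To see this, consider the loop generating functions `C̃^{{e₁};−e₁}₂(0,0;1/(2d−1))` and `C̃^{{e₁};e₂}₂(0,0;1/(2d−1))`,
which by symmetry are the only two geometries to be considered. … `μ^{(2̃,1)} = (2d−1)/C̃^{{e₁};e₂}₂(0,0;1/(2d−1)) =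
s⁻¹ − 1 − s − 3s² − 18s³ − 124s⁴ + O(s⁵)` (6.24) which has the correct coefficient of order `s²`".  Madras–Slade (1.1.8),
p. 5: "For high dimensions it is known that as `d → ∞`, `μ = 2d − 1 − 1/(2d) − 3/(2d)² + O(1/(2d)³)`" (an asymptotic
statement; the `s³` coefficient `−16` is HSS93 (6.18), not (1.1.8)).

## What is typed (standard axioms; no `sorry`)

* `nbwSquare a b = (a, b, −a, −b)`, the unit squares through the origin; for every ordered pair of DISTINCT directions
  `(t, s)` three pairwise disjoint families of squares violating the constraints of `closedNbwPen {e_t} s 4` — first step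
  `e_t` (`2d − 2` squares through `e_t` at time 1), second step `e_t` (`2d − 2`, through `e_t` at time 3), second step
  `e_s` with first step off the axes of `s` and `t` (`≥ 2d − 4`, last step `−e_s`) — whence the head count
  **`nbwLoopsPen_four_add_le : w̃₄ + (6d − 8) ≤ b₄(0)`** (`b₄(0) = 4d(d−1)`; for `d ≥ 2` the exact value is
  `w̃₄ = b₄(0) − (6d − 7)`, attained at `e_s ⟂ e_t`);
* `sum_nbwLoopsPen_mul_pow_le : Σ_{j≤K} w̃_j (2d−1)^{−j} ≤ B₀ − (6d−8)/(2d−1)⁴` and (HSS93 (2.39), `τ = 2̃`, `k = 1`, with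
  this `W`) **`hss_memoryTwo_squares_le_connectiveConstant (hd : 3 ≤ d) : (2d−1)/(B₀ − (6d−8)(2d−1)^{−4}) ≤ μ(ℤ^d)`**;
* ★ **`thirdOrder_sub_le_connectiveConstant (hd : 22 ≤ d) : 2d − 1 − 1/(2d) − 3/(4d²) − 95/d³ ≤ μ(ℤ^d)`** — the `s²`
  coefficient `−3` of (6.18)/(6.24) as an explicit all-`d ≥ 22` floor (the previous tree floors had `−4s²`:
  `kesten_third_order_renewal_sharp₁₁`, `GreenChernoff.kesten_renewal_sharp₄`); in `s`: `μ ≥ s⁻¹ − 1 − s − 3s² − 760s³`,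
  of which `724s³` is the `49/d⁴` slack of the Green-function enclosure (true coefficient `15/(4d⁴)`), `34s³` the
  square-level engine's and `2s³` the rounding to `95` (the printed (6.24) has `−18s³`; the truth is `−16s³`);
* ★ **`abs_connectiveConstant_sub_thirdOrder_le (hd : 2 ≤ d) : |μ(ℤ^d) − (2d − 1 − 1/(2d) − 3/(4d²))| ≤ 95/d³`** — with
  the memory-6 upper bound `+2/d³` and, for `2 ≤ d ≤ 21`, the two-term floor `−5/d²` (`17/(4d²) ≤ 95/d³` iff `d ≤ 22`).

NUMBERS. `95` is the least integer for which the cleared polynomial of the `d ≥ 22` step, `32d⁸ + 12488d⁷ − 18988d⁶ +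
15666d⁵ + 561493d⁴ − 1447261d³ + 1322114d² − 518492d + 74480`, is nonnegative on `d ≥ 22` (it is in fact positive for
all `d ≥ 1`; the supremum of `d³(2d − 1 − 1/(2d) − 3/(4d²) − (2d−1)/W⁺(d))` is `94.75`, approached as `d → ∞`); the
envelope at `d = 22, 50, 100`: `±0.0089`, `±7.6·10⁻⁴`, `±9.5·10⁻⁵` around `42.9757…`, `98.9897`, `198.994925`.
NOT CLAIMED: the printed `−18s³` of (6.24) (needs the VALUE of `C̃^{{e₁};e₂}₂`, §3.2), memories `τ ≥ 4`, `d ≤ 21` beyond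
the two-term floor.  Label (proposed): EFFECTIVE VERSION of the printed asymptotics (6.18)/(6.24) at order `s²` (lane:
consolidation; the novelty is the explicit, kernel-checked, all-`d` inequality — no new mathematics is claimed).
-/

noncomputable section

namespace Literature.Probability.RandomPlanarGeometry.SAW.Zd.LoopErasure

open Finset Filter Topology
open scoped BigOperators
open Literature.Probability.LatticeModels Literature.Probability.LatticeModels.SRW
open Literature.Probability.FitznerVanDerHofstad2017
open Literature.Probability.Percolation (IsNBW srev srev_srev)

variable {d : ℕ}

/-! ### Unit squares through the origin -/

/-- The square loop `(a, b, −a, −b)`. [cite: HaraSladeSokal1993, §6.3 p. 26 ("the number of squares …"; lane plumbing)] -/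
def nbwSquare (a b : Dir d) : StepSeq d 4 := ![a, b, a.neg, b.neg]

/-- [cite: HaraSladeSokal1993, §6.3 p. 26 (lane plumbing)] -/
theorem nbwSquare_mk_zero (a b : Dir d) (h : 0 < 4) : nbwSquare a b ⟨0, h⟩ = a := rfl
/-- [cite: HaraSladeSokal1993, §6.3 p. 26 (lane plumbing)] -/
theorem nbwSquare_mk_one (a b : Dir d) (h : 1 < 4) : nbwSquare a b ⟨1, h⟩ = b := rfl
/-- [cite: HaraSladeSokal1993, §6.3 p. 26 (lane plumbing)] -/
theorem nbwSquare_mk_two (a b : Dir d) (h : 2 < 4) : nbwSquare a b ⟨2, h⟩ = a.neg := rfl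
/-- [cite: HaraSladeSokal1993, §6.3 p. 26 (lane plumbing)] -/
theorem nbwSquare_mk_three (a b : Dir d) (h : 3 < 4) : nbwSquare a b ⟨3, h⟩ = b.neg := rfl

/-- Two directions on different axes are not opposite. [cite: HaraSladeSokal1993, §2.4 p. 10 (lane plumbing: nearest-neighbour directions of ℤ^d)] -/
theorem ne_neg_of_fst_ne {a b : Dir d} (h : b.1 ≠ a.1) : b ≠ a.neg := by
  intro hb
  exact h (by rw [hb]; rfl)

/-- A square with orthogonal sides is a non-backtracking word. [cite: HaraSladeSokal1993, §6.3 p. 26 (lane plumbing)] -/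
theorem isNBW_nbwSquare {a b : Dir d} (hab : b.1 ≠ a.1) : IsNBW (nbwSquare a b) := by
  intro k hk
  have hk3 : k = 0 ∨ k = 1 ∨ k = 2 := by omega
  rcases hk3 with rfl | rfl | rfl
  · show nbwSquare a b ⟨1, by norm_num⟩ ≠ srev (nbwSquare a b ⟨0, by norm_num⟩)
    rw [nbwSquare_mk_one, nbwSquare_mk_zero]
    exact ne_neg_of_fst_ne hab
  · show nbwSquare a b ⟨2, by norm_num⟩ ≠ srev (nbwSquare a b ⟨1, by norm_num⟩)
    rw [nbwSquare_mk_two, nbwSquare_mk_one]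
    exact ne_neg_of_fst_ne (show a.neg.1 ≠ b.1 from fun h => hab (h ▸ rfl))
  · show nbwSquare a b ⟨3, by norm_num⟩ ≠ srev (nbwSquare a b ⟨2, by norm_num⟩)
    rw [nbwSquare_mk_three, nbwSquare_mk_two]
    intro h
    have h' : b.neg.neg = a.neg.neg.neg := by rw [h]; rfl
    rw [Dir.neg_neg, Dir.neg_neg] at h'
    exact ne_neg_of_fst_ne hab h'

/-- A square closes at the origin. [cite: HaraSladeSokal1993, §6.3 p. 26 (lane plumbing)] -/
theorem endpoint_nbwSquare (a b : Dir d) : endpoint (nbwSquare a b) = 0 := by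
  simp only [endpoint, Fin.sum_univ_four]
  show stepVec a + stepVec b + stepVec a.neg + stepVec b.neg = 0
  rw [stepVec_neg, stepVec_neg]
  abel

/-- `nbwSquare a b` passes through `e_a` at time `1`. [cite: HaraSladeSokal1993, §6.3 p. 26 (lane plumbing)] -/
theorem pos_nbwSquare_one (a b : Dir d) : pos (nbwSquare a b) 1 = stepVec a := by
  rw [pos_succ (nbwSquare a b) (k := 0) (by norm_num), pos_zero, zero_add]
  rfl

/-- `nbwSquare a b` passes through `e_b` at time `3`. [cite: HaraSladeSokal1993, §6.3 p. 26 (lane plumbing)] -/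
theorem pos_nbwSquare_three (a b : Dir d) : pos (nbwSquare a b) 3 = stepVec b := by
  rw [pos_succ (nbwSquare a b) (k := 2) (by norm_num), pos_succ (nbwSquare a b) (k := 1) (by norm_num),
    pos_succ (nbwSquare a b) (k := 0) (by norm_num), pos_zero, zero_add]
  show stepVec a + stepVec b + stepVec a.neg = stepVec b
  rw [stepVec_neg]
  abel

/-- A square with orthogonal sides is a closed non-backtracking `4`-loop. [cite: HaraSladeSokal1993, §6.3 p. 26 (lane plumbing)] -/
theorem nbwSquare_mem_closedNbw {a b : Dir d} (hab : b.1 ≠ a.1) : nbwSquare a b ∈ closedNbw d 4 := by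
  classical
  rw [closedNbw, Finset.mem_filter]
  exact ⟨Finset.mem_univ _, isNBW_nbwSquare hab, endpoint_nbwSquare a b⟩

/-- `nbwSquare` is injective in its first side. [cite: HaraSladeSokal1993, §6.3 p. 26 (lane plumbing)] -/
theorem nbwSquare_inj_left {a a' b b' : Dir d} (h : nbwSquare a b = nbwSquare a' b') : a = a' := by
  have h0 := congrFun h ⟨0, by norm_num⟩
  rwa [nbwSquare_mk_zero, nbwSquare_mk_zero] at h0

/-- `nbwSquare` is injective in its second side. [cite: HaraSladeSokal1993, §6.3 p. 26 (lane plumbing)] -/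
theorem nbwSquare_inj_right {a a' b b' : Dir d} (h : nbwSquare a b = nbwSquare a' b') : b = b' := by
  have h1 := congrFun h ⟨1, by norm_num⟩
  rwa [nbwSquare_mk_one, nbwSquare_mk_one] at h1

/-! ### Counting directions off one or two axes -/

/-- The directions off the axis `i`: `2d − 2` of them. [cite: HaraSladeSokal1993, §2.4 p. 10 (lane plumbing: nearest-neighbour directions of ℤ^d)] -/
theorem card_dir_fst_ne (i : Fin d) :
    ((Finset.univ : Finset (Dir d)).filter fun b => b.1 ≠ i).card = 2 * d - 2 := by
  have e : ((Finset.univ : Finset (Dir d)).filter fun b => b.1 ≠ i) =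
      (Finset.univ.erase i) ×ˢ (Finset.univ : Finset Bool) := by
    ext ⟨j, c⟩
    simp only [Finset.mem_filter, Finset.mem_univ, true_and, Finset.mem_product, Finset.mem_erase, ne_eq,
      and_true]
  rw [e, Finset.card_product, Finset.card_erase_of_mem (Finset.mem_univ i), Finset.card_univ, Fintype.card_fin,
    Finset.card_univ, Fintype.card_bool]
  omega

/-- The directions off the axes `i` and `j`: at least `2d − 4` of them. [cite: HaraSladeSokal1993, §2.4 p. 10 (lane plumbing: nearest-neighbour directions of ℤ^d)] -/
theorem le_card_dir_fst_ne_ne (i j : Fin d) :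
    2 * d - 4 ≤ ((Finset.univ : Finset (Dir d)).filter fun b => b.1 ≠ i ∧ b.1 ≠ j).card := by
  have e : ((Finset.univ : Finset (Dir d)).filter fun b => b.1 ≠ i ∧ b.1 ≠ j) =
      ((Finset.univ.erase i).erase j) ×ˢ (Finset.univ : Finset Bool) := by
    ext ⟨k, c⟩
    simp only [Finset.mem_filter, Finset.mem_univ, true_and, Finset.mem_product, Finset.mem_erase, ne_eq, and_true]
    tauto
  rw [e, Finset.card_product, Finset.card_univ, Fintype.card_bool]
  have h1 : (Finset.univ.erase i).card = d - 1 := by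
    rw [Finset.card_erase_of_mem (Finset.mem_univ i), Finset.card_univ, Fintype.card_fin]
  have h2 : (Finset.univ.erase i).card - 1 ≤ ((Finset.univ.erase i).erase j).card := Finset.pred_card_le_card_erase
  omega

/-! ### The three violating families and the head count `w̃₄ + (6d − 8) ≤ b₄(0)` -/

/-- **Head count at `σ = 4`.** For distinct directions `t ≠ s`, at least `6d − 8` closed NBW `4`-loops (squares) violate
the constraints of `closedNbwPen {e_t} s 4`: those with first step `e_t`, those with second step `e_t` (both visit
`e_t`), and those with second step `e_s` and first step off the axes of `s`, `t` (last step `−e_s`).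
[cite: HaraSladeSokal1993, §6.3 eq. (6.24) p. 26 (the order-s² mechanism of τ = 2̃, k = 1: "combine the constraints involving the previous and next steps on the backbone")] -/
theorem card_closedNbwPen_four_add_le {t s : Dir d} (hts : t ≠ s) :
    (closedNbwPen {stepVec t} s 4).card + (6 * d - 8) ≤ nbwLoopsAll d 4 := by
  classical
  -- the three families
  set D₁ : Finset (Dir d) := Finset.univ.filter fun b => b.1 ≠ t.1 with hD₁
  set D₃ : Finset (Dir d) := Finset.univ.filter fun a => a.1 ≠ s.1 ∧ a.1 ≠ t.1 with hD₃
  set F₁ : Finset (StepSeq d 4) := D₁.image fun b => nbwSquare t b with hF₁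
  set F₂ : Finset (StepSeq d 4) := D₁.image fun a => nbwSquare a t with hF₂
  set F₃ : Finset (StepSeq d 4) := D₃.image fun a => nbwSquare a s with hF₃
  set P : Finset (StepSeq d 4) := closedNbwPen {stepVec t} s 4 with hP
  have hmemD₁ : ∀ {b : Dir d}, b ∈ D₁ ↔ b.1 ≠ t.1 := by
    intro b; simp only [hD₁, Finset.mem_filter, Finset.mem_univ, true_and]
  have hmemD₃ : ∀ {a : Dir d}, a ∈ D₃ ↔ a.1 ≠ s.1 ∧ a.1 ≠ t.1 := by
    intro a; simp only [hD₃, Finset.mem_filter, Finset.mem_univ, true_and]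
  -- cardinalities of the families
  have hcF₁ : F₁.card = 2 * d - 2 := by
    rw [hF₁, Finset.card_image_of_injective _ fun b b' h => nbwSquare_inj_right h, card_dir_fst_ne]
  have hcF₂ : F₂.card = 2 * d - 2 := by
    rw [hF₂, Finset.card_image_of_injective _ fun a a' h => nbwSquare_inj_left h, card_dir_fst_ne]
  have hcF₃ : 2 * d - 4 ≤ F₃.card := by
    rw [hF₃, Finset.card_image_of_injective _ fun a a' h => nbwSquare_inj_left h]
    exact le_card_dir_fst_ne_ne s.1 t.1
  -- all families consist of closed NBW loops outside `P`
  have hsub : P ∪ (F₁ ∪ F₂ ∪ F₃) ⊆ closedNbw d 4 := by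
    intro ω hω
    rcases Finset.mem_union.1 hω with h | h
    · rw [hP, mem_closedNbwPen] at h
      rw [closedNbw, Finset.mem_filter]
      exact ⟨Finset.mem_univ _, h.2.1, h.1.1⟩
    rcases Finset.mem_union.1 h with h | h
    · rcases Finset.mem_union.1 h with h | h
      · obtain ⟨b, hb, rfl⟩ := Finset.mem_image.1 h
        exact nbwSquare_mem_closedNbw (hmemD₁.1 hb)
      · obtain ⟨a, ha, rfl⟩ := Finset.mem_image.1 h
        exact nbwSquare_mem_closedNbw (fun h' => (hmemD₁.1 ha) h'.symm)
    · obtain ⟨a, ha, rfl⟩ := Finset.mem_image.1 h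
      exact nbwSquare_mem_closedNbw (fun h' => (hmemD₃.1 ha).1 h'.symm)
  have hPF : Disjoint P (F₁ ∪ F₂ ∪ F₃) := by
    rw [Finset.disjoint_left]
    intro ω hωP hωF
    rw [hP, mem_closedNbwPen] at hωP
    obtain ⟨⟨-, hav⟩, -, hlast⟩ := hωP
    rcases Finset.mem_union.1 hωF with h | h
    · rcases Finset.mem_union.1 h with h | h
      · obtain ⟨b, -, rfl⟩ := Finset.mem_image.1 h
        exact hav 1 (by norm_num) (by rw [pos_nbwSquare_one]; exact Finset.mem_singleton_self _)
      · obtain ⟨a, -, rfl⟩ := Finset.mem_image.1 h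
        exact hav 3 (by norm_num) (by rw [pos_nbwSquare_three]; exact Finset.mem_singleton_self _)
    · obtain ⟨a, -, rfl⟩ := Finset.mem_image.1 h
      exact hlast ⟨3, by norm_num⟩ rfl (by rw [nbwSquare_mk_three]; rfl)
  have h₁₂ : Disjoint F₁ F₂ := by
    rw [Finset.disjoint_left]
    intro ω h1 h2
    obtain ⟨b, -, rfl⟩ := Finset.mem_image.1 h1
    obtain ⟨a, ha, he⟩ := Finset.mem_image.1 h2
    exact hmemD₁.1 ha (by rw [nbwSquare_inj_left he])
  have h₁₃ : Disjoint F₁ F₃ := by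
    rw [Finset.disjoint_left]
    intro ω h1 h3
    obtain ⟨b, -, rfl⟩ := Finset.mem_image.1 h1
    obtain ⟨a, ha, he⟩ := Finset.mem_image.1 h3
    exact (hmemD₃.1 ha).2 (by rw [nbwSquare_inj_left he])
  have h₂₃ : Disjoint F₂ F₃ := by
    rw [Finset.disjoint_left]
    intro ω h2 h3
    obtain ⟨a, -, rfl⟩ := Finset.mem_image.1 h2
    obtain ⟨a', -, he⟩ := Finset.mem_image.1 h3
    exact hts (nbwSquare_inj_right he).symm
  have hcardF : (F₁ ∪ F₂ ∪ F₃).card = F₁.card + F₂.card + F₃.card := by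
    rw [Finset.card_union_of_disjoint (Finset.disjoint_union_left.2 ⟨h₁₃, h₂₃⟩),
      Finset.card_union_of_disjoint h₁₂]
  have htot : P.card + (F₁ ∪ F₂ ∪ F₃).card ≤ (closedNbw d 4).card := by
    rw [← Finset.card_union_of_disjoint hPF]
    exact Finset.card_le_card hsub
  rw [nbwLoopsAll]
  rw [hcardF, hcF₁, hcF₂] at htot
  omega

/-- **`w̃₄ + (6d − 8) ≤ b₄(0)`** (`d ≥ 1`): the penalised loop number at `σ = 4` misses at least `6d − 8` of the `4d(d−1)`
squares. [cite: HaraSladeSokal1993, §6.3 eq. (6.24) p. 26 (order-s² mechanism of τ = 2̃, k = 1)] -/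
theorem nbwLoopsPen_four_add_le (hd : 1 ≤ d) : nbwLoopsPen d 4 + (6 * d - 8) ≤ nbwLoopsAll d 4 := by
  -- one pair of distinct directions exists, so `6d − 8 ≤ b₄(0)`
  set t₀ : Dir d := (⟨0, hd⟩, true) with ht₀
  have hne : t₀ ≠ t₀.neg := fun h => by
    have h2 := congrArg Prod.snd h
    simp [ht₀, Dir.neg] at h2
  have h0 : 6 * d - 8 ≤ nbwLoopsAll d 4 := le_of_add_le_right (card_closedNbwPen_four_add_le hne)
  have hsup : nbwLoopsPen d 4 ≤ nbwLoopsAll d 4 - (6 * d - 8) := by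
    refine Finset.sup_le fun p hp => ?_
    have hp' : p.1 ≠ p.2 := (Finset.mem_filter.1 hp).2
    have h := card_closedNbwPen_four_add_le (d := d) hp' 
    omega
  omega

/-! ### The bound `W = B₀ − (6d−8)(2d−1)^{−4}` on the penalised loop generating function -/

/-- **`Σ_{j≤K} w̃_j (2d−1)^{−j} ≤ B₀ − (6d − 8)/(2d−1)⁴`** for every `K` (`d ≥ 3`, `B₀ = ((2d−2)/(2d−1)) G_d`): the
partial sums are monotone, `w̃_j ≤ b_j(0)` termwise, and at `j = 4` the head count bites.
[cite: HaraSladeSokal1993, §2.4 eq. (2.36)–(2.39) p. 10–11 with §6.3 (6.24) p. 26] -/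
theorem sum_nbwLoopsPen_mul_pow_le (hd : 3 ≤ d) (K : ℕ) :
    ∑ j ∈ range (K + 1), (nbwLoopsPen d j : ℝ) * (1 / (2 * (d : ℝ) - 1)) ^ j ≤
      (2 * (d : ℝ) - 2) / (2 * (d : ℝ) - 1) * srwI d 1 0 0 - ((6 * d - 8 : ℕ) : ℝ) * (1 / (2 * (d : ℝ) - 1)) ^ 4 := by
  set β : ℝ := 1 / (2 * (d : ℝ) - 1) with hβdef
  have hd3 : (3 : ℝ) ≤ d := by exact_mod_cast hd
  have hβ0 : 0 ≤ β := (one_div_pos.2 (by linarith)).le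
  have hnn : ∀ j, 0 ≤ (nbwLoopsPen d j : ℝ) * β ^ j := fun j => mul_nonneg (Nat.cast_nonneg _) (pow_nonneg hβ0 _)
  -- enlarge the range to contain `4`
  have hKK : K + 1 ≤ K + 4 + 1 := by omega
  have hmono : ∑ j ∈ range (K + 1), (nbwLoopsPen d j : ℝ) * β ^ j ≤
      ∑ j ∈ range (K + 4 + 1), (nbwLoopsPen d j : ℝ) * β ^ j :=
    Finset.sum_le_sum_of_subset_of_nonneg (Finset.range_subset_range.2 hKK) fun j _ _ => hnn j
  refine hmono.trans ?_
  rw [le_sub_iff_add_le]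
  have h4 : 4 ∈ range (K + 4 + 1) := Finset.mem_range.2 (by omega)
  have hconst : ((6 * d - 8 : ℕ) : ℝ) * β ^ 4 =
      ∑ j ∈ range (K + 4 + 1), (if j = 4 then ((6 * d - 8 : ℕ) : ℝ) * β ^ j else 0) := by
    rw [Finset.sum_ite_eq' (range (K + 4 + 1)) 4 (fun j => ((6 * d - 8 : ℕ) : ℝ) * β ^ j), if_pos h4]
  rw [hconst, ← Finset.sum_add_distrib]
  refine le_trans (Finset.sum_le_sum fun j _ => ?_) (sum_nbwLoopsAll_mul_pow_le hd (K + 4))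
  split_ifs with hj
  · subst hj
    rw [← add_mul]
    refine mul_le_mul_of_nonneg_right ?_ (pow_nonneg hβ0 _)
    exact_mod_cast nbwLoopsPen_four_add_le (d := d) (by omega)
  · rw [add_zero]
    exact mul_le_mul_of_nonneg_right (by exact_mod_cast nbwLoopsPen_le j) (pow_nonneg hβ0 _)

/-- `W = B₀ − (6d−8)(2d−1)^{−4} > 0` (`d ≥ 3`; indeed `W ≥ 4/5 − 3/125`). [cite: HaraSladeSokal1993, §2.4 eq. (2.39) p. 11 (lane plumbing)] -/
theorem memoryTwo_squares_W_pos (hd : 3 ≤ d) :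
    0 < (2 * (d : ℝ) - 2) / (2 * (d : ℝ) - 1) * srwI d 1 0 0 - ((6 * d - 8 : ℕ) : ℝ) * (1 / (2 * (d : ℝ) - 1)) ^ 4 := by
  have hd3 : (3 : ℝ) ≤ d := by exact_mod_cast hd
  have hpos : (0 : ℝ) < 2 * (d : ℝ) - 1 := by linarith
  have hG1 : 1 ≤ srwI d 1 0 0 := one_le_srwI_one hd
  have hrat : (4 : ℝ) / 5 ≤ (2 * (d : ℝ) - 2) / (2 * (d : ℝ) - 1) := by
    rw [div_le_div_iff₀ (by norm_num) hpos]; linarith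
  have hB : (4 : ℝ) / 5 ≤ (2 * (d : ℝ) - 2) / (2 * (d : ℝ) - 1) * srwI d 1 0 0 := by
    have h0 : (0 : ℝ) ≤ (2 * (d : ℝ) - 2) / (2 * (d : ℝ) - 1) := le_trans (by norm_num) hrat
    nlinarith
  have hc : ((6 * d - 8 : ℕ) : ℝ) ≤ 3 * (2 * (d : ℝ) - 1) := by
    have h8 : 8 ≤ 6 * d := by omega
    rw [Nat.cast_sub h8]
    push_cast
    linarith
  have hβ1 : (1 : ℝ) / (2 * (d : ℝ) - 1) ≤ 1 / 5 :=
    div_le_div_of_nonneg_left (by norm_num) (by norm_num) (by linarith)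
  have hβ0 : (0 : ℝ) ≤ 1 / (2 * (d : ℝ) - 1) := (one_div_pos.2 hpos).le
  have hβ3 : (1 / (2 * (d : ℝ) - 1)) ^ 3 ≤ (1 / 5 : ℝ) ^ 3 := pow_le_pow_left₀ hβ0 hβ1 3
  have hcβ : ((6 * d - 8 : ℕ) : ℝ) * (1 / (2 * (d : ℝ) - 1)) ^ 4 ≤ 3 * (1 / 5 : ℝ) ^ 3 := by
    calc ((6 * d - 8 : ℕ) : ℝ) * (1 / (2 * (d : ℝ) - 1)) ^ 4
        ≤ 3 * (2 * (d : ℝ) - 1) * (1 / (2 * (d : ℝ) - 1)) ^ 4 :=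
          mul_le_mul_of_nonneg_right hc (pow_nonneg hβ0 4)
      _ = 3 * (1 / (2 * (d : ℝ) - 1)) ^ 3 := by
          rw [pow_succ, show 3 * (2 * (d : ℝ) - 1) * ((1 / (2 * (d : ℝ) - 1)) ^ 3 * (1 / (2 * (d : ℝ) - 1))) =
            3 * (1 / (2 * (d : ℝ) - 1)) ^ 3 * ((2 * (d : ℝ) - 1) * (1 / (2 * (d : ℝ) - 1))) by ring,
            mul_one_div_cancel hpos.ne', mul_one]
      _ ≤ 3 * (1 / 5 : ℝ) ^ 3 := by linarith
  norm_num at hcβ ⊢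
  linarith

/-- **Hara–Slade–Sokal (2.39) with `τ = 2̃`, `k = 1` and the square-level bound on `Π̃₂`**: for every `d ≥ 3`,
`(2d − 1) / (((2d−2)/(2d−1)) G_d − (6d − 8)/(2d−1)⁴) ≤ μ(ℤ^d)`.
[cite: HaraSladeSokal1993, §2.4 eq. (2.39) p. 11 (τ = 2, k = 1, second version) with §6.3 (6.24) p. 26] -/
theorem hss_memoryTwo_squares_le_connectiveConstant (hd : 3 ≤ d) :
    (2 * (d : ℝ) - 1) /
        ((2 * (d : ℝ) - 2) / (2 * (d : ℝ) - 1) * srwI d 1 0 0 - ((6 * d - 8 : ℕ) : ℝ) * (1 / (2 * (d : ℝ) - 1)) ^ 4) ≤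
      connectiveConstant d :=
  hss_memoryTwo_div_le_connectiveConstant hd (memoryTwo_squares_W_pos hd) (sum_nbwLoopsPen_mul_pow_le hd)

/-! ### The third-order floor and envelope -/

/-- ★ **`2d − 1 − 1/(2d) − 3/(4d²) − 95/d³ ≤ μ(ℤ^d)` for every `d ≥ 22`** — the `s²` coefficient `−3` of the `1/d`
expansion `μ = s⁻¹ − 1 − s − 3s² − 16s³ − …` (HSS93 (6.18); Madras–Slade (1.1.8) prints it through `−3s²`; `s = 1/(2d)`) as an explicit lower
bound, from the memory-2̃ loop erasure with the square-level `Π̃₂` and the Green-function enclosure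
`G_d ≤ 1 + 1/(2d) + 3/(4d²) + 3/(2d³) + 49/d⁴`.
[cite: HaraSladeSokal1993, §6.3 eq. (6.18) p. 25 and eq. (6.24) p. 26 ("has the correct coefficient of order s²"); MadrasSlade1993, §1.1 (1.1.8) p. 5; lane certificate] -/
theorem thirdOrder_sub_le_connectiveConstant (hd : 22 ≤ d) :
    2 * (d : ℝ) - 1 - 1 / (2 * (d : ℝ)) - 3 / (4 * (d : ℝ) ^ 2) - 95 / (d : ℝ) ^ 3 ≤ connectiveConstant d := by
  have hd3 : 3 ≤ d := by omega
  have hd0 : (0 : ℝ) < d := by exact_mod_cast (show 0 < d by omega)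
  have hd22 : (22 : ℝ) ≤ d := by exact_mod_cast hd
  have hpos : (0 : ℝ) < 2 * (d : ℝ) - 1 := by linarith
  have hG := GreenChernoff.srwI_one_le_sharp₄ hd
  set Gp : ℝ := 1 + 1 / (2 * (d : ℝ)) + 3 / (4 * (d : ℝ) ^ 2) + 3 / (2 * (d : ℝ) ^ 3) + 49 / (d : ℝ) ^ 4 with hGp
  set W : ℝ := (2 * (d : ℝ) - 2) / (2 * (d : ℝ) - 1) * srwI d 1 0 0 -
    ((6 * d - 8 : ℕ) : ℝ) * (1 / (2 * (d : ℝ) - 1)) ^ 4 with hWdef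
  set Wp : ℝ := (2 * (d : ℝ) - 2) / (2 * (d : ℝ) - 1) * Gp - (6 * (d : ℝ) - 8) / (2 * (d : ℝ) - 1) ^ 4 with hWp
  have hW0 : 0 < W := memoryTwo_squares_W_pos hd3
  have hcast : ((6 * d - 8 : ℕ) : ℝ) * (1 / (2 * (d : ℝ) - 1)) ^ 4 = (6 * (d : ℝ) - 8) / (2 * (d : ℝ) - 1) ^ 4 := by
    rw [Nat.cast_sub (by omega : 8 ≤ 6 * d), one_div_pow, mul_one_div]
    push_cast
    ring
  have hWW : W ≤ Wp := by
    rw [hWdef, hWp, hcast]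
    have hρ : (0 : ℝ) ≤ (2 * (d : ℝ) - 2) / (2 * (d : ℝ) - 1) := div_nonneg (by linarith) hpos.le
    have := mul_le_mul_of_nonneg_left hG hρ
    linarith
  have hWp0 : 0 < Wp := lt_of_lt_of_le hW0 hWW
  have hfloor : 2 * (d : ℝ) - 1 - 1 / (2 * (d : ℝ)) - 3 / (4 * (d : ℝ) ^ 2) - 95 / (d : ℝ) ^ 3 ≤
      (2 * (d : ℝ) - 1) / Wp := by
    rw [le_div_iff₀ hWp0, ← sub_nonneg]
    have key : 2 * (d : ℝ) - 1 -
        (2 * (d : ℝ) - 1 - 1 / (2 * (d : ℝ)) - 3 / (4 * (d : ℝ) ^ 2) - 95 / (d : ℝ) ^ 3) * Wp =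
        (32 * (d : ℝ) ^ 8 + 12488 * (d : ℝ) ^ 7 - 18988 * (d : ℝ) ^ 6 + 15666 * (d : ℝ) ^ 5 + 561493 * (d : ℝ) ^ 4 -
          1447261 * (d : ℝ) ^ 3 + 1322114 * (d : ℝ) ^ 2 - 518492 * (d : ℝ) + 74480) /
          (8 * (d : ℝ) ^ 7 * (2 * (d : ℝ) - 1) ^ 4) := by
      rw [hWp, hGp]
      field_simp
      ring
    rw [key]
    refine div_nonneg ?_ (by positivity)
    have hy : (0 : ℝ) ≤ (d : ℝ) - 22 := by linarith
    have key2 : 32 * (d : ℝ) ^ 8 + 12488 * (d : ℝ) ^ 7 - 18988 * (d : ℝ) ^ 6 + 15666 * (d : ℝ) ^ 5 +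
        561493 * (d : ℝ) ^ 4 - 1447261 * (d : ℝ) ^ 3 + 1322114 * (d : ℝ) ^ 2 - 518492 * (d : ℝ) + 74480 =
        32 * ((d : ℝ) - 22) ^ 8 + 18120 * ((d : ℝ) - 22) ^ 7 + 2337828 * ((d : ℝ) - 22) ^ 6 +
          143518498 * ((d : ℝ) - 22) ^ 5 + 5043193153 * ((d : ℝ) - 22) ^ 4 + 107704024107 * ((d : ℝ) - 22) ^ 3 +
          1389601779040 * ((d : ℝ) - 22) ^ 2 + 10002850934784 * ((d : ℝ) - 22) + 30950199680168 := by
      ring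
    rw [key2]
    positivity
  calc 2 * (d : ℝ) - 1 - 1 / (2 * (d : ℝ)) - 3 / (4 * (d : ℝ) ^ 2) - 95 / (d : ℝ) ^ 3
      ≤ (2 * (d : ℝ) - 1) / Wp := hfloor
    _ ≤ (2 * (d : ℝ) - 1) / W := div_le_div_of_nonneg_left hpos.le hW0 hWW
    _ ≤ connectiveConstant d := hss_memoryTwo_squares_le_connectiveConstant hd3

/-- ★ **The three-term envelope: `|μ(ℤ^d) − (2d − 1 − 1/(2d) − 3/(4d²))| ≤ 95/d³` for every `d ≥ 2`** (upper side:
the memory-6 bound `+2/d³`; lower side: the floor above for `d ≥ 22`, the two-term floor `−5/d²` for `d ≤ 21`).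
Madras–Slade (1.1.8) `μ = 2d − 1 − 1/(2d) − 3/(2d)² + O(1/(2d)³)`, made effective (explicit constant, every `d ≥ 2`).
[cite: MadrasSlade1993, §1.1 (1.1.8) p. 5; HaraSladeSokal1993, §6.3 eq. (6.18) p. 25; lane certificate] -/
theorem abs_connectiveConstant_sub_thirdOrder_le (hd : 2 ≤ d) :
    |connectiveConstant d - (2 * (d : ℝ) - 1 - 1 / (2 * (d : ℝ)) - 3 / (4 * (d : ℝ) ^ 2))| ≤ 95 / (d : ℝ) ^ 3 := by
  have hd0 : (0 : ℝ) < d := by exact_mod_cast (show 0 < d by omega)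
  have hd2 : (2 : ℝ) ≤ d := by exact_mod_cast hd
  have hup := connectiveConstant_le_thirdOrder hd
  have h2le : (2 : ℝ) / (d : ℝ) ^ 3 ≤ 95 / (d : ℝ) ^ 3 := by gcongr; norm_num
  rw [abs_le]
  refine ⟨?_, by linarith⟩
  rcases Nat.lt_or_ge d 22 with hlt | hge
  · have hlow := twoTerm_sub_five_div_sq_le_connectiveConstant hd
    have hd21 : (d : ℝ) ≤ 21 := by exact_mod_cast (show d ≤ 21 by omega)
    have h17 : (5 : ℝ) / (d : ℝ) ^ 2 - 3 / (4 * (d : ℝ) ^ 2) ≤ 95 / (d : ℝ) ^ 3 := by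
      rw [show (5 : ℝ) / (d : ℝ) ^ 2 - 3 / (4 * (d : ℝ) ^ 2) = 17 / (4 * (d : ℝ) ^ 2) by field_simp; ring,
        div_le_div_iff₀ (by positivity) (by positivity)]
      nlinarith [pow_pos hd0 2]
    linarith
  · have hlow := thirdOrder_sub_le_connectiveConstant hge
    linarith

end Literature.Probability.RandomPlanarGeometry.SAW.Zd.LoopErasure

end
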